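import Mathlib
import Summits.ValiantsHypothesis.ValiantsHypothesis.Theorems.FeketeSOSCharPSparseSOSMultiPieceBarrier
import Summits.ValiantsHypothesis.ValiantsHypothesis.Theorems.FeketeSOSCharPSparseSOSCoreSumClique

/-!
# Crux `FeketeSOS.CharPSparseSOS` (stmt-ValiantsHypothesis-14989) — the Paley sum-clique PARTITION wall
in one declaration: the crux implies robust non-packing of the quadratic residues by `≤ p^δ` restricted
sumsets

`robustNoPacking_of_charPSparseSOS` : the crux `CharPSparseSOS` implies, for some `δ > 0` and all large
primes `p`: for every family `Q_0, …, Q_{s'−1} ⊆ 𝔽_p` with `s' ≤ p^δ` pieces,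
`p^{1/2+δ} ≤ 3 Σ_i |Q_i| + 2·#{n ∈ 𝔽_p : Σ_i r_{Q_i}(n) ≠ 1_QR(n)}`, where
`r_Q(n) = #{(a, b) ∈ Q × Q : val a < val b, a + b = n}` is the restricted pair-sum count and
`1_QR(n) = [n ≠ 0 ∧ (n|p) = 1]`.  The conclusion is, verbatim, the body of `Strategist.RobustNoPacking`
of the crux's STRATEGY-CENSUS (§Decomposition D1, Sub_A): an exact or near-exact partition of the quadratic
residues into few restricted sumsets of Paley sum-cliques of size `≍ √(p/s')` — the configurations of
crux NOTES §I (♦) (`p = 13`: `{0,1,3,9}`; `p = 41`: `{1,7,24,35,38} ⊔ −{1,7,24,35,38}`) — would be a cheap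
cyclic SOS representation of `F̄_p`, so every proof of the crux excludes them with a POWER to spare; for
`s' ≥ 2` the pieces lie below every clique-type bound on record (`√(p/2) + 1` for the Paley graph,
`√p + 3/2` by completion and `|Q⁺|·|Q| ≤ (p−1)/2` by Stepanov for sum-cliques).  Proof: transport the
pieces to their representatives in `[0, p)` (the `ℕ`-indexed error count is at most the `𝔽_p`-indexed
one), apply the multi-piece barrier `rQs_far_from_QR_of_charPSparseSOS` (crux exponent `δ₀`,
`3s' + 6 ≤ p^{δ₀}` squares) and absorb `2s' + 13√p + 13` into the power: with `δ = δ₀/2` and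
`P = p^{δ} ≥ 6`, `√p·P² − 2P − 13√p − 13 ≥ √p·P`.  (Lead c6 of the crux; `--supports`.)
-/

-- `Summit.ValiantsHypothesis.ValiantsHypothesis.…` is the tree's mandated single-conjunct layout (Sub = Summit).
set_option linter.dupNamespace false

namespace Summit.ValiantsHypothesis.ValiantsHypothesis.Theorems.CharPSparseSOSTwoCusp

open Finset

/-! ## Transport `ZMod p → ℕ` of restricted pair-sum counts and error sets -/

/-- The restricted pair-sum count of the representatives at `n < p` equals the restricted pair-sum count
of `Q ⊆ ZMod p` at `(n : ZMod p)`. -/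
theorem rnp_pairCount_transport {p : ℕ} [Fact p.Prime] (Q : Finset (ZMod p)) (n : ℕ) (hn : n < p) :
    (((Q.image ZMod.val) ×ˢ (Q.image ZMod.val)).filter
        (fun ab : ℕ × ℕ => ab.1 < ab.2 ∧ (ab.1 + ab.2) % p = n)).card =
      ((Q ×ˢ Q).filter (fun ab : ZMod p × ZMod p => ab.1.val < ab.2.val ∧ ab.1 + ab.2 = n)).card := by
  have hp : p.Prime := Fact.out
  haveI : NeZero p := ⟨hp.ne_zero⟩
  symm
  refine card_nbij' (fun ab => (ab.1.val, ab.2.val)) (fun xy => ((xy.1 : ZMod p), (xy.2 : ZMod p)))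
    ?_ ?_ ?_ ?_
  · intro ab hab
    rw [mem_coe, mem_filter, mem_product] at hab
    obtain ⟨⟨ha, hb⟩, hlt, hsum⟩ := hab
    rw [mem_coe, mem_filter, mem_product]
    refine ⟨⟨mem_image_of_mem _ ha, mem_image_of_mem _ hb⟩, hlt, ?_⟩
    rw [← ZMod.val_add, hsum, ZMod.val_natCast, Nat.mod_eq_of_lt hn]
  · intro xy hxy
    rw [mem_coe, mem_filter, mem_product, mem_image, mem_image] at hxy
    obtain ⟨⟨⟨a, ha, hx⟩, ⟨b, hb, hy⟩⟩, hlt, hsum⟩ := hxy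
    rw [mem_coe, mem_filter, mem_product]
    have hxp : xy.1 < p := hx ▸ ZMod.val_lt a
    have hyp : xy.2 < p := hy ▸ ZMod.val_lt b
    refine ⟨⟨?_, ?_⟩, ?_, ?_⟩
    · show ((xy.1 : ℕ) : ZMod p) ∈ Q
      rw [← hx, ZMod.natCast_zmod_val]; exact ha
    · show ((xy.2 : ℕ) : ZMod p) ∈ Q
      rw [← hy, ZMod.natCast_zmod_val]; exact hb
    · rwa [ZMod.val_natCast, ZMod.val_natCast, Nat.mod_eq_of_lt hxp, Nat.mod_eq_of_lt hyp]
    · rw [← Nat.cast_add, ← ZMod.natCast_mod (xy.1 + xy.2) p, hsum]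
  · intro ab _
    simp only [ZMod.natCast_zmod_val]
  · intro xy hxy
    rw [mem_coe, mem_filter, mem_product, mem_image, mem_image] at hxy
    obtain ⟨⟨⟨a, _, hx⟩, ⟨b, _, hy⟩⟩, -, -⟩ := hxy
    have hxp : xy.1 < p := hx ▸ ZMod.val_lt a
    have hyp : xy.2 < p := hy ▸ ZMod.val_lt b
    ext
    · show (xy.1 : ZMod p).val = xy.1
      rw [ZMod.val_natCast, Nat.mod_eq_of_lt hxp]
    · show (xy.2 : ZMod p).val = xy.2
      rw [ZMod.val_natCast, Nat.mod_eq_of_lt hyp]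

/-- **Error-set transport.**  The `ℕ`-indexed Hamming error of the representatives (as in
`rQs_far_from_QR_of_charPSparseSOS`) is at most the `ZMod p`-indexed Hamming error of the pieces
(as in `Strategist.RobustNoPacking`); in fact they are equal, only `≤` is used. -/
theorem rnp_card_err_transport {p : ℕ} [Fact p.Prime] (s' : ℕ) (Qs : Fin s' → Finset (ZMod p)) :
    ((range p).filter (fun n => (∑ i, ((((Qs i).image ZMod.val) ×ˢ ((Qs i).image ZMod.val)).filter
        (fun ab : ℕ × ℕ => ab.1 < ab.2 ∧ (ab.1 + ab.2) % p = n)).card) ≠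
          (if n ≠ 0 ∧ legendreSym p n = 1 then 1 else 0))).card ≤
      ((Finset.univ : Finset (ZMod p)).filter (fun n =>
        (∑ i, (((Qs i) ×ˢ (Qs i)).filter (fun ab => ab.1.val < ab.2.val ∧ ab.1 + ab.2 = n)).card) ≠
          (if n ≠ 0 ∧ legendreSym p n.val = 1 then 1 else 0))).card := by
  have hp : p.Prime := Fact.out
  haveI : NeZero p := ⟨hp.ne_zero⟩
  refine card_le_card_of_injOn (fun n : ℕ => (n : ZMod p)) ?_ ?_
  · intro n hn
    rw [mem_coe, mem_filter] at hn
    obtain ⟨hnp, hne⟩ := hn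
    rw [mem_range] at hnp
    rw [mem_coe, mem_filter]
    refine ⟨mem_univ _, ?_⟩
    have hcount : (∑ i, (((Qs i) ×ˢ (Qs i)).filter
        (fun ab => ab.1.val < ab.2.val ∧ ab.1 + ab.2 = (n : ZMod p))).card) =
        ∑ i, ((((Qs i).image ZMod.val) ×ˢ ((Qs i).image ZMod.val)).filter
          (fun ab : ℕ × ℕ => ab.1 < ab.2 ∧ (ab.1 + ab.2) % p = n)).card :=
      sum_congr rfl fun i _ => (rnp_pairCount_transport (Qs i) n hnp).symm
    have hval : (n : ZMod p).val = n := by rw [ZMod.val_natCast, Nat.mod_eq_of_lt hnp]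
    have hzero : ((n : ZMod p) ≠ 0) ↔ n ≠ 0 := by
      rw [Ne, ZMod.natCast_eq_zero_iff]
      constructor
      · intro h h0; exact h (h0 ▸ dvd_zero p)
      · intro h hdvd; exact h (Nat.eq_zero_of_dvd_of_lt hdvd hnp)
    rw [hcount, hval]
    simp only [hzero]
    exact hne
  · intro n hn m hm hnm
    rw [mem_coe, mem_filter, mem_range] at hn hm
    have := congrArg ZMod.val hnm
    rwa [ZMod.val_natCast, ZMod.val_natCast, Nat.mod_eq_of_lt hn.1, Nat.mod_eq_of_lt hm.1] at this

/-! ## The wall: the crux implies robust non-packing -/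

/-- Real bookkeeping: with `P ≥ 6` and `√p ≥ 2`, `√p·P² − 2P − 13√p − 13 ≥ √p·P`. -/
theorem rnp_real_bookkeeping (r P : ℝ) (hr : 2 ≤ r) (hP : 6 ≤ P) :
    r * P ≤ r * (P * P) - 2 * P - 13 * r - 13 := by
  have f1 : 0 ≤ r * P * (P - 6) := mul_nonneg (mul_nonneg (by linarith) (by linarith)) (by linarith)
  have f2 : 0 ≤ (P - 6) * (5 * r - 2) := mul_nonneg (by linarith) (by linarith)
  nlinarith [f1, f2]

/-- **The crux implies robust non-packing of the quadratic residues (the partition wall).**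
`CharPSparseSOS` implies: for some `δ > 0` and all large primes `p`, every family of `s' ≤ p^δ` subsets
`Q_i ⊆ 𝔽_p` has `p^{1/2+δ} ≤ 3 Σ_i |Q_i| + 2·#{n : Σ_i r_{Q_i}(n) ≠ 1_QR(n)}` — the body of
`Strategist.CoreSumClique`'s sibling `Strategist.RobustNoPacking` (STRATEGY-CENSUS §D1), verbatim.  In
words: the quadratic residues of a large prime are `p^{1/2+δ}`-far (in the weighted Hamming sense
`3 Σ|Q_i| + 2 #Err`) from every packing by at most `p^δ` restricted sumsets.  The one-piece exact case
is Shkredov's theorem (`QR ≠ A +̂ A` for `p > 13`); nothing in print covers `s' ≥ 2` pieces, let alone a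
power to spare — the Paley sum-clique partition barrier of the crux memos, now a tree implication. -/
theorem robustNoPacking_of_charPSparseSOS :
    Summit.ValiantsHypothesis.ValiantsHypothesis.Theses.FeketeSOS.CharPSparseSOS →
      ∃ δ : ℝ, 0 < δ ∧ ∃ p₀ : ℕ, ∀ (p : ℕ) [Fact p.Prime], p₀ ≤ p →
        ∀ (s' : ℕ) (Qs : Fin s' → Finset (ZMod p)), (s' : ℝ) ≤ (p : ℝ) ^ δ →
        (p : ℝ) ^ (1 / 2 + δ) ≤ 3 * ∑ i, ((Qs i).card : ℝ) +
          2 * (((Finset.univ : Finset (ZMod p)).filter (fun n =>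
              (∑ i, (((Qs i) ×ˢ (Qs i)).filter
                (fun ab => ab.1.val < ab.2.val ∧ ab.1 + ab.2 = n)).card) ≠
                (if n ≠ 0 ∧ legendreSym p n.val = 1 then 1 else 0))).card : ℝ) := by
  intro hcrux
  obtain ⟨δ, hδ, p₁, H⟩ := rQs_far_from_QR_of_charPSparseSOS hcrux
  refine ⟨δ / 2, half_pos hδ, max p₁ (max 5 ⌈(6 : ℝ) ^ (2 / δ)⌉₊), ?_⟩
  intro p _ hp s' Qs hs'
  have hprime : p.Prime := Fact.out
  have hp₁ : p₁ ≤ p := le_of_max_le_left hp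
  have hp5 : 5 ≤ p := le_of_max_le_left (le_of_max_le_right hp)
  have hceil : ⌈(6 : ℝ) ^ (2 / δ)⌉₊ ≤ p := le_of_max_le_right (le_of_max_le_right hp)
  have hpR5 : (5 : ℝ) ≤ (p : ℝ) := by exact_mod_cast hp5
  have hp0 : (0 : ℝ) < (p : ℝ) := by linarith
  -- `P = p^{δ/2} ≥ 6`
  set P : ℝ := (p : ℝ) ^ (δ / 2) with hPdef
  have hP0 : 0 ≤ P := Real.rpow_nonneg hp0.le _
  have hP6 : 6 ≤ P := by
    have h1 : (6 : ℝ) ^ (2 / δ) ≤ (p : ℝ) := le_trans (Nat.le_ceil _) (by exact_mod_cast hceil)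
    have h2 : ((6 : ℝ) ^ (2 / δ)) ^ (δ / 2) ≤ (p : ℝ) ^ (δ / 2) :=
      Real.rpow_le_rpow (by positivity) h1 (half_pos hδ).le
    rwa [← Real.rpow_mul (by norm_num), show (2 / δ) * (δ / 2) = 1 by field_simp, Real.rpow_one] at h2
  have hPP : (p : ℝ) ^ δ = P * P := by
    rw [hPdef, ← Real.rpow_add hp0, add_halves]
  have hsqrt2 : (2 : ℝ) ≤ Real.sqrt p := by
    rw [show (2 : ℝ) = Real.sqrt 4 by
      rw [show (4 : ℝ) = 2 ^ 2 by norm_num, Real.sqrt_sq (by norm_num)]]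
    exact Real.sqrt_le_sqrt (by linarith)
  -- the number of squares `3s' + 6 ≤ 3P + 6 ≤ P² = p^δ`
  have hsq : (((s' + s' + s' + 6 : ℕ)) : ℝ) ≤ (p : ℝ) ^ δ := by
    push_cast
    rw [hPP]
    nlinarith [mul_nonneg (sub_nonneg.2 hP6) (by linarith : (0 : ℝ) ≤ P + 3)]
  -- the multi-piece barrier for the representatives
  have hbar := H p hp₁ s' (fun i => (Qs i).image ZMod.val) (fun i => csq_image_val_lt (Qs i)) hsq
  simp only [csq_card_image_val] at hbar
  have herr := rnp_card_err_transport s' Qs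
  have herrR : ((((range p).filter (fun n => (∑ i, ((((Qs i).image ZMod.val) ×ˢ
      ((Qs i).image ZMod.val)).filter
        (fun ab : ℕ × ℕ => ab.1 < ab.2 ∧ (ab.1 + ab.2) % p = n)).card) ≠
          (if n ≠ 0 ∧ legendreSym p n = 1 then 1 else 0))).card : ℕ) : ℝ) ≤
      ((((Finset.univ : Finset (ZMod p)).filter (fun n =>
        (∑ i, (((Qs i) ×ˢ (Qs i)).filter (fun ab => ab.1.val < ab.2.val ∧ ab.1 + ab.2 = n)).card) ≠
          (if n ≠ 0 ∧ legendreSym p n.val = 1 then 1 else 0))).card : ℕ) : ℝ) := by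
    exact_mod_cast herr
  -- exponents: `p^{1/2+δ} = √p · P²`, `p^{1/2+δ/2} = √p · P`
  have hbig : (p : ℝ) ^ (1 / 2 + δ) = Real.sqrt p * (P * P) := by
    rw [Real.rpow_add hp0, Real.sqrt_eq_rpow, hPP]
  have hsmall : (p : ℝ) ^ (1 / 2 + δ / 2) = Real.sqrt p * P := by
    rw [Real.rpow_add hp0, Real.sqrt_eq_rpow]
  rw [hbig] at hbar
  rw [hsmall]
  have hkey := rnp_real_bookkeeping (Real.sqrt p) P hsqrt2 hP6
  linarith

end Summit.ValiantsHypothesis.ValiantsHypothesis.Theorems.CharPSparseSOSTwoCusp
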